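import Summits.QuantumFields.GaugeBoot.ZdCentralTwistStates
import HarnessLib

/-!
# The `ℤ^d` staggered central twist on the Class-B and Class-T interfaces: every axiom but full
# diagonal reflection positivity transfers (gauge-boot, L3 structural supplement; `ℤ^d` twist 5)

HONEST FRAMING (cell `pub-gaugeboot`, page 1 of every file): the venture produces certified bounds
on lattice expectations at stated coupling, gauge group, dimension and torus size; NOT a mass gap,
NOT a continuum limit, NOT a string tension; NOT Yang–Mills-summit-bearing (barriers
`FixedCouplingUltralocality`, `PerturbativeInvisibility`). This module bounds no expectation; no
certificate of the cell sits at `β < 0`.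

`ZdCentralTwistStates.lean` showed that the twist `T_r = centralTwist (stagTwist π r z)` (`ρ z = -1`)
of a gauge-invariant state carries link reflection positivity along the LAST axis `r` for all half
observables, and along the other axes for gauge-invariant half observables. Since for a
gauge-invariant state the twisted state does not depend on `r` (`map_centralTwist_stagTwist_eq_of_last`),
link RP in fact transfers along EVERY axis for ALL half observables:

* ★★ `linkRP_map_centralTwist_of_gaugeInvariantMeasure` — full link-mirror RP, every axis;
* ★★★ `ClassBState.twist_allButDiag` — the twist of a Class-B state at `β` with gauge-invariant
  measure satisfies EVERY Class-B axiom at `-β` (probability, translation / permutation / reflection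
  invariance, one-link Gibbs identity at `-β`, site RP and link RP in every axis for all half
  observables) EXCEPT full diagonal RP, which holds on gauge-invariant half observables
  (`ClassBState.twist_summary`) and FAILS in some plane when `β > 0` (`ClassBState.exists_not_diagRP_twist`);
* `not_diagRP_of_integral_plaquetteObs_neg` — a state with a NEGATIVE plaquette expectation in the
  `(i, j)` plane at the origin is not `(i, j)`-diagonally RP (contrapositive of the cut-plaquette
  positivity `integral_re_trace_plaquette_nonneg_of_isReflectionPositiveFor_diag`); hence
  ★ `not_diagRP_map_centralTwist_of_integral_plaquetteObs_pos` — the twist of ANY state with a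
  positive `(i, j)` plaquette violates full `(i, j)`-diagonal RP (every `d`);
* CLASS T (`TiltedBoxLimitClass.lean`, one diagonal pair `(i, j)`): ★★ `TiltedClassState.twist_summary`
  — the twist of a Class-T state at `β` with gauge-invariant measure is translation-, swap- and
  reflection-invariant, a one-link Gibbs state at `-β`, site-RP and link-RP along every transverse
  axis for all half observables, and `(i, j)`-diagonally RP on gauge-invariant half observables;
  ★ `TiltedClassState.not_diagRP_twist_of_plaquette_pos` — but if the Class-T state has a positive
  `(i, j)` plaquette, its twist violates full `(i, j)`-diagonal RP, so it is NOT a Class-T state at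
  `-β`. Consequently the open question "is Class T inhabited at `β < 0` in `d ≥ 3`?"
  (`TiltedClassNegativeCouplingTwoDim.lean`: empty in `d = 2`) is NOT settled by twisting: a twisted
  Class-T state is Class T only if the original state has a non-positive `(i, j)` plaquette.

Structural; NOT a bound on any expectation; nothing for `SU(2n+1)`. [folklore] bookkeeping.
-/

noncomputable section

open MeasureTheory
open scoped ComplexOrder
open Literature.Probability.LatticeModels (Site)
open Literature.MathematicalPhysics.QuantumLattice

namespace Summit.QuantumFields.GaugeBoot

namespace TiltedRP

variable {d N : ℕ} {G : Type*} [Group G] [TopologicalSpace G] [IsTopologicalGroup G]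
  [CompactSpace G] [MeasurableSpace G] [BorelSpace G] [SecondCountableTopology G]
variable (ρ : G →* Matrix (Fin N) (Fin N) ℂ) {z : G} {π : Fin d → Site d →+ ZMod 2}

/-! ## Link RP along every axis -/

omit [CompactSpace G] in
/-- ★★ **Link-mirror reflection positivity passes to the twisted state of a GAUGE-INVARIANT state for
all half observables, along every axis** (the twisted state does not depend on the last axis, and
along the last axis the link reflection commutes with the twist). -/
theorem linkRP_map_centralTwist_of_gaugeInvariantMeasure (hπ : IsDualParity (zdUnit d) π)
    (hzc : ∀ g : G, z * g = g * z) (hz2 : z * z = 1) (r i : Fin d) {S : Set (ZdEdge d)}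
    {μ : Measure (LGConfig d G)} (hμG : ∀ k : Site d → G, μ.map (gaugeTransformZd k) = μ)
    (hRP : IsReflectionPositiveFor (configLinkReflect i) S μ) :
    IsReflectionPositiveFor (configLinkReflect i) S (μ.map (centralTwist (stagTwist π r z))) := by
  rw [map_centralTwist_stagTwist_eq_of_last hπ hzc hz2 i r hμG]
  exact linkRP_map_centralTwist_last hπ hzc hz2 i hRP

/-! ## Class B: everything but full diagonal RP -/

omit [CompactSpace G] in
/-- ★★★ **The twist of a Class-B state satisfies every Class-B axiom at `-β` except full diagonal
reflection positivity** (`ρ z = -1`, gauge-invariant measure): probability, translation invariance,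
axis-permutation and axis-reflection invariance, the one-link Gibbs identity at `-β`, site RP and
link RP in EVERY axis for ALL half observables; diagonal RP holds on gauge-invariant half
observables (`ClassBState.twist_summary`) and fails in some plane for `β > 0`
(`ClassBState.exists_not_diagRP_twist`). -/
theorem _root_.Summit.QuantumFields.GaugeBoot.ClassBState.twist_allButDiag
    (hπ : IsDualParity (zdUnit d) π) (hzc : ∀ g : G, z * g = g * z) (hz2 : z * z = 1)
    (hρ : Continuous ρ) (hρz : ρ z = -1) (r : Fin d) {β : ℝ} (ω : ClassBState d ρ β)
    (hωG : ∀ k : Site d → G, ω.μ.map (gaugeTransformZd k) = ω.μ) :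
    IsProbabilityMeasure (ω.μ.map (centralTwist (stagTwist π r z))) ∧
    IsZdTranslationInvariant (ω.μ.map (centralTwist (stagTwist π r z))) ∧
    (∀ σ : Equiv.Perm (Fin d), MeasurePreserving (configPerm σ)
      (ω.μ.map (centralTwist (stagTwist π r z))) (ω.μ.map (centralTwist (stagTwist π r z)))) ∧
    (∀ i : Fin d, MeasurePreserving (configSiteReflect i)
      (ω.μ.map (centralTwist (stagTwist π r z))) (ω.μ.map (centralTwist (stagTwist π r z)))) ∧
    IsHaarShiftState ρ (-β) (ω.μ.map (centralTwist (stagTwist π r z))) ∧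
    (∀ i : Fin d, IsReflectionPositiveFor (configSiteReflect i) (siteHalfEdges i)
      (ω.μ.map (centralTwist (stagTwist π r z)))) ∧
    (∀ i : Fin d, IsReflectionPositiveFor (configLinkReflect i) (linkHalfEdges i)
      (ω.μ.map (centralTwist (stagTwist π r z)))) := by
  obtain ⟨hP, hT, hPerm, hRefl, hH, hSite, -⟩ := ω.twist_summary ρ hπ hzc hz2 hρ hρz r hωG
  exact ⟨hP, hT, hPerm, hRefl, hH, hSite,
    fun i => linkRP_map_centralTwist_of_gaugeInvariantMeasure hπ hzc hz2 r i hωG (ω.linkRP i)⟩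

/-! ## Positive plaquettes obstruct diagonal RP of the twisted state -/

omit [SecondCountableTopology G] in
/-- **A negative `(i, j)` plaquette at the origin obstructs `(i, j)`-diagonal RP** (contrapositive of
the cut-plaquette positivity of `CutLoopCharacterPositivity.lean`). -/
theorem not_diagRP_of_integral_plaquetteObs_neg (hρ : Continuous ρ) {μ : Measure (LGConfig d G)}
    [IsFiniteMeasure μ] {i j : Fin d} (hij : i ≠ j)
    (hneg : ∫ U, plaquetteObs ρ 0 i j U ∂μ < 0) :
    ¬ IsReflectionPositiveFor (configDiagSwapZd i j) (diagHalfEdges i j) μ := fun hRP =>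
  absurd (integral_re_trace_plaquette_nonneg_of_isReflectionPositiveFor_diag ρ hρ hij hRP)
    (not_le.2 hneg)

/-- ★ **The twist of any state with a positive `(i, j)` plaquette violates full `(i, j)`-diagonal
RP** (its `(i, j)` plaquette is negative). -/
theorem not_diagRP_map_centralTwist_of_integral_plaquetteObs_pos {s : ZdEdge d → G}
    (hs : IsStaggering (zdUnit d) z s) (hρ : Continuous ρ) (hρz : ρ z = -1)
    {μ : Measure (LGConfig d G)} [IsFiniteMeasure μ] {i j : Fin d} (hij : i ≠ j)
    (hpos : 0 < ∫ U, plaquetteObs ρ 0 i j U ∂μ) :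
    ¬ IsReflectionPositiveFor (configDiagSwapZd i j) (diagHalfEdges i j)
      (μ.map (centralTwist s)) := by
  haveI : IsFiniteMeasure (μ.map (centralTwist s)) :=
    Measure.isFiniteMeasure_map μ (centralTwist s)
  refine not_diagRP_of_integral_plaquetteObs_neg ρ hρ hij ?_
  rw [integral_map_centralTwist s μ (continuous_plaquetteObs ρ hρ 0 i j)]
  simp_rw [hs.plaquetteObs_centralTwist ρ hρz 0 hij]
  rw [integral_neg]
  linarith

/-! ## Class T: everything but full `(i, j)`-diagonal RP -/

omit [CompactSpace G] in
/-- ★★ **The twist of a Class-T state** (one diagonal pair `(i, j)`; `ρ z = -1`, gauge-invariant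
measure): the twisted state at `-β` is a probability measure, translation invariant, invariant under
the transposition `(i j)` and the axis reflections, a one-link Gibbs state at `-β`, site-RP and
link-RP along every transverse axis for all half observables, and `(i, j)`-diagonally RP on all
gauge-invariant half observables. -/
theorem TiltedClassState.twist_summary (hπ : IsDualParity (zdUnit d) π)
    (hzc : ∀ g : G, z * g = g * z) (hz2 : z * z = 1) (hρ : Continuous ρ) (hρz : ρ z = -1)
    (r : Fin d) {i j : Fin d} {β : ℝ} (ω : TiltedClassState d i j ρ β)
    (hωG : ∀ k : Site d → G, ω.μ.map (gaugeTransformZd k) = ω.μ) :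
    IsProbabilityMeasure (ω.μ.map (centralTwist (stagTwist π r z))) ∧
    IsZdTranslationInvariant (ω.μ.map (centralTwist (stagTwist π r z))) ∧
    MeasurePreserving (configPerm (Equiv.swap i j))
      (ω.μ.map (centralTwist (stagTwist π r z))) (ω.μ.map (centralTwist (stagTwist π r z))) ∧
    (∀ m : Fin d, MeasurePreserving (configSiteReflect m)
      (ω.μ.map (centralTwist (stagTwist π r z))) (ω.μ.map (centralTwist (stagTwist π r z)))) ∧
    IsHaarShiftState ρ (-β) (ω.μ.map (centralTwist (stagTwist π r z))) ∧
    (∀ k : Fin d, k ≠ i → k ≠ j → IsReflectionPositiveFor (configSiteReflect k) (siteHalfEdges k)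
      (ω.μ.map (centralTwist (stagTwist π r z)))) ∧
    (∀ k : Fin d, k ≠ i → k ≠ j → IsReflectionPositiveFor (configLinkReflect k) (linkHalfEdges k)
      (ω.μ.map (centralTwist (stagTwist π r z)))) ∧
    (∀ F : LGConfig d G → ℂ, Measurable F → (∃ C : ℝ, ∀ U, ‖F U‖ ≤ C) →
      DependsOn F (diagHalfEdges i j) → IsZdGaugeInvariant F →
        0 ≤ ∫ U, (starRingEnd ℂ) (F (configDiagSwapZd i j U)) * F U
          ∂(ω.μ.map (centralTwist (stagTwist π r z)))) := by
  haveI := ω.isProbabilityMeasure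
  have hs := isStaggering_stagTwist (e := zdUnit d) hπ r hzc hz2
  have hcomm : ∀ (l : ZdEdge d) (g : G), stagTwist π r z l * g = g * stagTwist π r z l :=
    fun l g => by unfold stagTwist zpow₂; split_ifs <;> simp [hzc]
  refine ⟨isProbabilityMeasure_map_centralTwist _ _,
    isZdTranslationInvariant_map_centralTwist hzc hz2 r ω.translationInvariant hωG,
    measurePreserving_map_centralTwist_of_conj hcomm (measurable_pi_lambda _ fun _ => measurable_pi_apply _)
      (fun U => configPerm_centralTwist_stagTwist hπ hzc hz2 r (Equiv.swap i j) U) ω.swapInvariant hωG,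
    reflectInvariant_map_centralTwist hπ hzc hz2 r ω.reflectInvariant hωG,
    ω.haarShift.map_centralTwist ρ hs hρ hρz,
    fun k hki hkj => siteRP_map_centralTwist hπ hzc hz2 r k (ω.siteRP k hki hkj),
    fun k hki hkj => linkRP_map_centralTwist_of_gaugeInvariantMeasure hπ hzc hz2 r k hωG
      (ω.linkRP k hki hkj),
    fun F hFm hFb hFS hFG => diagRP_map_centralTwist_of_gaugeInvariant hπ hzc hz2 r i j ω.diagRP
      hFm hFb hFS hFG⟩

/-- ★ **… but a Class-T state with a positive `(i, j)` plaquette twists to a state violating full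
`(i, j)`-diagonal RP**, hence NOT underlying any Class-T state at `-β`: twisting does not settle
the inhabitation of Class T at negative coupling in `d ≥ 3`. -/
theorem TiltedClassState.not_diagRP_twist_of_plaquette_pos (hπ : IsDualParity (zdUnit d) π)
    (hzc : ∀ g : G, z * g = g * z) (hz2 : z * z = 1) (hρ : Continuous ρ) (hρz : ρ z = -1)
    (r : Fin d) {i j : Fin d} (hij : i ≠ j) {β : ℝ} (ω : TiltedClassState d i j ρ β)
    (hpos : 0 < ∫ U, plaquetteObs ρ 0 i j U ∂ω.μ) :
    ¬ IsReflectionPositiveFor (configDiagSwapZd i j) (diagHalfEdges i j)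
        (ω.μ.map (centralTwist (stagTwist π r z))) ∧
      ∀ ω' : TiltedClassState d i j ρ (-β), ω'.μ ≠ ω.μ.map (centralTwist (stagTwist π r z)) := by
  haveI := ω.isProbabilityMeasure
  have h := not_diagRP_map_centralTwist_of_integral_plaquetteObs_pos ρ
    (isStaggering_stagTwist (e := zdUnit d) hπ r hzc hz2) hρ hρz hij hpos
  exact ⟨h, fun ω' hω' => h (hω' ▸ ω'.diagRP)⟩

/-- The same for Class B: a Class-B state with a positive plaquette in the `(i, j)` plane twists to a
state violating full `(i, j)`-diagonal RP (every real `β`, every `d`; for `β > 0` SOME plane always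
fails, `ClassBState.exists_not_diagRP_twist`). -/
theorem _root_.Summit.QuantumFields.GaugeBoot.ClassBState.not_diagRP_twist_of_plaquette_pos
    (hπ : IsDualParity (zdUnit d) π) (hzc : ∀ g : G, z * g = g * z) (hz2 : z * z = 1)
    (hρ : Continuous ρ) (hρz : ρ z = -1) (r : Fin d) {i j : Fin d} (hij : i ≠ j) {β : ℝ}
    (ω : ClassBState d ρ β) (hpos : 0 < ∫ U, plaquetteObs ρ 0 i j U ∂ω.μ) :
    ¬ IsReflectionPositiveFor (configDiagSwapZd i j) (diagHalfEdges i j)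
      (ω.μ.map (centralTwist (stagTwist π r z))) := by
  haveI := ω.isProbabilityMeasure
  exact not_diagRP_map_centralTwist_of_integral_plaquetteObs_pos ρ
    (isStaggering_stagTwist (e := zdUnit d) hπ r hzc hz2) hρ hρz hij hpos

end TiltedRP

end Summit.QuantumFields.GaugeBoot
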